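import Summits.RiemannHypothesis.RiemannHypothesis.Theses.SignCone
import Summits.RiemannHypothesis.RiemannHypothesis.Theorems.SignConeConeMagnificationCompactness
import Summits.RiemannHypothesis.RiemannHypothesis.Theorems.SignConeConeMagnificationStubFakePNT
import Summits.RiemannHypothesis.RiemannHypothesis.Theorems.SignConeConeMagnificationStubChebyshev
import Summits.RiemannHypothesis.RiemannHypothesis.Theorems.SignConeConeMagnificationStubContinuation
import Summits.RiemannHypothesis.RiemannHypothesis.Theorems.SignConeConeMagnificationStubTransfer
import Summits.RiemannHypothesis.RiemannHypothesis.Theorems.SignConeConeMagnificationStubPdLaplace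
import Summits.RiemannHypothesis.RiemannHypothesis.Theorems.SignConeConeMagnificationStubCara
import Summits.RiemannHypothesis.RiemannHypothesis.Theorems.SignConeConeMagnificationStubDeficitOfDesign

/-!
# `SignCone.ConeMagnification` from two zero-free pieces (BC2-redirect assembly)
(route `SignCone`, item stmt-RiemannHypothesis-16303 `ConeMagnification`; HELPER file, `--supports`;
crux-strategist unit `cstrat-stmt-RiemannHypothesis-16303-r1`)

The crux `ConeMagnification` ("a unit-slack fake von Mangoldt weight at every cutoff forces RH") is
implied by RH and is the 2001 MAGNIFICATION theorem W-MAG (archive `rh-w-magnification/free/y1`,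
Thm 1.2, unpublished).  This file proves, sorry-free, that it FOLLOWS from two statements neither of
which mentions a zero of `ζ`, the Riemann hypothesis or its negation:

* piece 1 `SlackDesign` (the analytic core, W-MAG Thm 3.1 / prop:abs / eq:LO at slack `M = 1`): a weight
  `c ≥ 0`, `c 1 = 0`, with unit slack against EVERY Weil test, whose `L`-series converges absolutely on
  `re s > 1` and whose `L_c − 1/(s−1)` has the Carathéodory majorant on `re s > 1/2`, satisfies the
  DESIGN DATA: (AX-A) `Σₙ |c−Λ|(n)/n < ∞`, (AX-B) the composite-mass series converges, (AX-C) the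
  Riesz–Euler design inequality with constant `1/2`;
* piece 2 `DeficitOfDesign` (the finite spine, W-MAG §5 Thm 5.4; kernel-checked in the prior programme's
  stockroom over exactly this interface, `Rh_WMagnificationY1_MagDeficit.lean`, `deficit_summable`):
  design data ⇒ `Σ_p (log p − c(p))₊ p^{-σ} < ∞` for every `σ > 1/2`;

via seven LANDED theorems (eight for the second theorem): slack-cone compactness `coneMagnification_of_uniform` (p129201: one weight
for all cutoffs), `stub_fakePNT` (p130740), `stub_chebyshev` (p131015), `stub_continuation` (p130893),
`stub_pdLaplace` (p132066), `stub_cara` (p133591) and the Landau transfer `stub_transfer` (p130783).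
The two pieces are stated over Mathlib primitives only (route CONE NOTE) so that the gate can install
them verbatim as the route's children of `ConeMagnification` (`route edit --split … --glue-by
ConeMagnification_of_subs`); the Literature vocabulary of the landed theorems (`IsWeilTest`, `weilConv`,
`weilReflect`, `weilPolarTerm`, `weilArchTerm`) is definitionally equal to it.
Relation to the lead's line `Cruxes/ConeMagnification/Lines/Sketch.lean` (r6): piece 2 is its
`stub_deficitOfDesign` verbatim; piece 1 is its `stub_designOfOffline` WITHOUT the hypotheses `¬RH` and
`stub_combZeroSide` (so piece 1 is zero-free and strictly stronger; the comb zero-side lemma is a helper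
of its proof, not part of its statement).
-/

noncomputable section

-- `Summit.RiemannHypothesis.RiemannHypothesis.…` repeats a namespace component by design (D-0017 layout).
set_option linter.dupNamespace false

open scoped BigOperators ComplexConjugate Topology
open Complex MeasureTheory Set Filter

namespace Summit.RiemannHypothesis.RiemannHypothesis.Theorems.SignConeConeMagnification

open Literature.NumberTheory.LFunctions
open Summit.RiemannHypothesis.RiemannHypothesis.Theorems.SignCone
open Summit.RiemannHypothesis.RiemannHypothesis.Cruxes.ConeMagnification.Sketch

/-- **`ConeMagnification` from the two zero-free pieces** (`SlackDesign → DeficitOfDesign →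
ConeMagnification`, both hypotheses written out over Mathlib primitives).  By slack-cone compactness it
suffices to treat ONE weight `c ≥ 0`, `c 1 = 0`, with unit slack against every Weil test; the fake
prime number theorem and Chebyshev bound give absolute convergence of `L_c` on `re s > 1`, the Laplace
argument continues `L_c − 1/(s−1)` to `re s > 1/2`, Laplace positivity gives the Carathéodory majorant,
piece 1 turns these into the design data, piece 2 into prime-deficit summability beyond `1/2`, and the
Landau transfer concludes RH. [folklore] -/
theorem ConeMagnification_of_subs :
    (∀ c : ℕ → ℝ, (∀ n, 0 ≤ c n) → c 1 = 0 →
    (∀ g : ℝ → ℂ, (ContDiff ℝ ((⊤ : ℕ∞) : WithTop ℕ∞) g ∧ HasCompactSupport g) → let G : ℝ → ℂ := MeasureTheory.convolution g (fun u => (starRingEnd ℂ) (g (-u))) (ContinuousLinearMap.mul ℂ ℂ) MeasureTheory.MeasureSpace.volume; let M : ℂ → ℂ := fun s => ∫ u : ℝ, G u * Complex.exp ((s - 1 / 2) * u); -(∫ t, ‖g t‖ ^ 2) ≤ (M 0 + M 1 + ((1 / (2 * Real.pi) : ℂ) * (∫ t : ℝ, M (1 / 2 + t * Complex.I) * ((Complex.digamma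 (1 / 4 + t / 2 * Complex.I)).re : ℂ)) - G 0 * (Real.log Real.pi : ℂ)) - ∑' n : ℕ, ((c n : ℝ) : ℂ) / (Real.sqrt n : ℂ) * (G (Real.log n) + G (-Real.log n))).re) →
    (∀ σ : ℝ, 1 < σ → LSeriesSummable (fun n => ((c n : ℝ) : ℂ)) σ) →
    (∃ F : ℂ → ℂ, DifferentiableOn ℂ F {s : ℂ | 1 / 2 < s.re} ∧
      (∀ s : ℂ, 1 < s.re → F s = LSeries (fun n => ((c n : ℝ) : ℂ)) s - 1 / (s - 1)) ∧
      ∀ s : ℂ, 1 / 2 < s.re →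
        (F s).re ≤ 1 / 2 + (1 / s).re +
          1 / (2 * Real.pi) * (∫ v : ℝ, (Complex.digamma (1 / 4 + v / 2 * Complex.I)).re *
            ((s.re - 1 / 2) / ((s.re - 1 / 2) ^ 2 + (s.im - v) ^ 2))) - Real.log Real.pi / 2) →
    Summable (fun n : ℕ => |c n - ArithmeticFunction.vonMangoldt n| / (n : ℝ)) ∧
    Summable (fun n : ℕ => if 2 ≤ n ∧ ¬ IsPrimePow n then
      c n / (n : ℝ) * (∑ q ∈ n.primeFactors, ∑ q' ∈ n.primeFactors.filter (fun q' => q < q'),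
        ((Real.sqrt q - 1) / 2) * ((Real.sqrt q' - 1) / 2)) else 0) ∧
    (∀ S : Finset ℕ, (∀ p ∈ S, p.Prime) → ∀ a : ℕ → ℝ, (∀ p ∈ S, 0 ≤ a p ∧ a p ≤ 1) → ∀ φ : ℝ,
      (∑' n : ℕ, (c n - ArithmeticFunction.vonMangoldt n) / (n : ℝ) *
        (if ∀ p ∈ S, ¬ (p ^ 2 ∣ n) then
          Real.sqrt (∏ p ∈ S.filter (· ∣ n), (p : ℝ)) * (∏ p ∈ S.filter (· ∣ n), a p) *
            (1 / 2) ^ (S.filter (· ∣ n)).card * Real.cos (((S.filter (· ∣ n)).card : ℝ) * φ)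
        else 0)) ≤ 1 / 2)) →
    (∀ c : ℕ → ℝ, (∀ n, 0 ≤ c n) → c 1 = 0 →
    Summable (fun n : ℕ => |c n - ArithmeticFunction.vonMangoldt n| / (n : ℝ)) →
    Summable (fun n : ℕ => if 2 ≤ n ∧ ¬ IsPrimePow n then
      c n / (n : ℝ) * (∑ q ∈ n.primeFactors, ∑ q' ∈ n.primeFactors.filter (fun q' => q < q'),
        ((Real.sqrt q - 1) / 2) * ((Real.sqrt q' - 1) / 2)) else 0) →
    (∀ S : Finset ℕ, (∀ p ∈ S, p.Prime) → ∀ a : ℕ → ℝ, (∀ p ∈ S, 0 ≤ a p ∧ a p ≤ 1) → ∀ φ : ℝ,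
      (∑' n : ℕ, (c n - ArithmeticFunction.vonMangoldt n) / (n : ℝ) *
        (if ∀ p ∈ S, ¬ (p ^ 2 ∣ n) then
          Real.sqrt (∏ p ∈ S.filter (· ∣ n), (p : ℝ)) * (∏ p ∈ S.filter (· ∣ n), a p) *
            (1 / 2) ^ (S.filter (· ∣ n)).card * Real.cos (((S.filter (· ∣ n)).card : ℝ) * φ)
        else 0)) ≤ 1 / 2) →
    ∀ σ : ℝ, 1 / 2 < σ →
      Summable (fun p : ℕ => if p.Prime then max (Real.log p - c p) 0 / (p : ℝ) ^ σ else 0)) →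
    Summit.RiemannHypothesis.RiemannHypothesis.Theses.SignCone.ConeMagnification := by
  intro h₁ h₂
  refine coneMagnification_of_uniform ?_
  rintro ⟨c, hc0, hc1, hU⟩
  -- fake PNT with O(1) error, Chebyshev (σ > 1), continuation of `L_c − 1/(s−1)` to `re s > 1/2`
  have hPNT := stub_fakePNT c hc0 hU
  have hsum := stub_chebyshev c hc0 hPNT
  have hcont := stub_continuation c hc0 hPNT hsum
  -- Laplace positivity and the Carathéodory majorant
  have hPD := stub_pdLaplace c hc0 hU
  have hF := stub_cara c hc0 hc1 hU hsum hcont hPD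
  -- piece 1: design data; piece 2: prime-deficit summability for σ > 1/2
  obtain ⟨hA, hB, hC⟩ := h₁ c hc0 hc1 hU hsum hF
  have hdef := h₂ c hc0 hc1 hA hB hC
  -- Landau transfer
  exact stub_transfer c hc0 hsum hcont hdef

/-- **`ConeMagnification` from piece 1 ALONE** (state of the tree since 2026-08-17T02:09Z: piece 2
`DeficitOfDesign` is the landed `stub_deficitOfDesign`, p137772).  Modulo landed theorems the crux is therefore
implied by ONE zero-free statement, `SlackDesign` (unit slack ⇒ design data), which is strictly stronger than the
crux (it has content in the RH world: design data for the exotic infinite-support members of the uniform cone) and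
is not implied by RH. [folklore] -/
theorem ConeMagnification_of_slackDesign :
    (∀ c : ℕ → ℝ, (∀ n, 0 ≤ c n) → c 1 = 0 →
    (∀ g : ℝ → ℂ, (ContDiff ℝ ((⊤ : ℕ∞) : WithTop ℕ∞) g ∧ HasCompactSupport g) → let G : ℝ → ℂ := MeasureTheory.convolution g (fun u => (starRingEnd ℂ) (g (-u))) (ContinuousLinearMap.mul ℂ ℂ) MeasureTheory.MeasureSpace.volume; let M : ℂ → ℂ := fun s => ∫ u : ℝ, G u * Complex.exp ((s - 1 / 2) * u); -(∫ t, ‖g t‖ ^ 2) ≤ (M 0 + M 1 + ((1 / (2 * Real.pi) : ℂ) * (∫ t : ℝ, M (1 / 2 + t * Complex.I) * ((Complex.digamma (1 / 4 + t / 2 * Complex.I)).re : ℂ)) - G 0 * (Real.log Real.pi : ℂ)) - ∑' n : ℕ, ((c n : ℝ) : ℂ) / (Real.sqrt n : ℂ) * (G (Real.log n) + G (-Real.log n))).re) →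
    (∀ σ : ℝ, 1 < σ → LSeriesSummable (fun n => ((c n : ℝ) : ℂ)) σ) →
    (∃ F : ℂ → ℂ, DifferentiableOn ℂ F {s : ℂ | 1 / 2 < s.re} ∧
      (∀ s : ℂ, 1 < s.re → F s = LSeries (fun n => ((c n : ℝ) : ℂ)) s - 1 / (s - 1)) ∧
      ∀ s : ℂ, 1 / 2 < s.re →
        (F s).re ≤ 1 / 2 + (1 / s).re +
          1 / (2 * Real.pi) * (∫ v : ℝ, (Complex.digamma (1 / 4 + v / 2 * Complex.I)).re *
            ((s.re - 1 / 2) / ((s.re - 1 / 2) ^ 2 + (s.im - v) ^ 2))) - Real.log Real.pi / 2) →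
    Summable (fun n : ℕ => |c n - ArithmeticFunction.vonMangoldt n| / (n : ℝ)) ∧
    Summable (fun n : ℕ => if 2 ≤ n ∧ ¬ IsPrimePow n then
      c n / (n : ℝ) * (∑ q ∈ n.primeFactors, ∑ q' ∈ n.primeFactors.filter (fun q' => q < q'),
        ((Real.sqrt q - 1) / 2) * ((Real.sqrt q' - 1) / 2)) else 0) ∧
    (∀ S : Finset ℕ, (∀ p ∈ S, p.Prime) → ∀ a : ℕ → ℝ, (∀ p ∈ S, 0 ≤ a p ∧ a p ≤ 1) → ∀ φ : ℝ,
      (∑' n : ℕ, (c n - ArithmeticFunction.vonMangoldt n) / (n : ℝ) *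
        (if ∀ p ∈ S, ¬ (p ^ 2 ∣ n) then
          Real.sqrt (∏ p ∈ S.filter (· ∣ n), (p : ℝ)) * (∏ p ∈ S.filter (· ∣ n), a p) *
            (1 / 2) ^ (S.filter (· ∣ n)).card * Real.cos (((S.filter (· ∣ n)).card : ℝ) * φ)
        else 0)) ≤ 1 / 2)) →
    Summit.RiemannHypothesis.RiemannHypothesis.Theses.SignCone.ConeMagnification :=
  fun h₁ => ConeMagnification_of_subs h₁ stub_deficitOfDesign

end Summit.RiemannHypothesis.RiemannHypothesis.Theorems.SignConeConeMagnification

end
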